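import Summits.SmoothPoincare4.SmoothPoincare4.Theses.SymplecticOrigami
import Literature.Topology.FourManifolds.SchoenfliesTools
import Literature.Topology.FourManifolds.DisjunctionLemma
import Literature.Topology.FourManifolds.ImmersionOrientation

/-!
# Stub `stub_pinch_foldSubmersion` of line `pair-rigidity-endgame` (crux `SymplecticOrigami.OrigamiRung`)

A registered sub-goal of the lead's stub `stub_pinch`: **the blow-down restricted to the fold
factors through the exceptional surface as a surjective submersion.**  Let `β : M → N` be the
blow-down of a piece `V` (open, `M` compact) of the fold decomposition, smooth near `closure V`,
mapping `V` onto `N ∖ B` for the embedded compact surface `B = range b` (`b : S → N` a smooth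
embedding) and the fold `frontier V = range z` (`z : Z → M` a smooth embedding of a `3`-manifold)
into `B`, with `dim ker dβ = 1` along the fold.  Then `β ∘ z = b ∘ φ` for a smooth surjective
submersion `φ : Z → S`.

* smoothness of the lift `φ` is read off the composite with the embedding `b`
  (`SchoenfliesTools.contMDiff_of_comp_isSmoothEmbedding`);
* `dφ_p` is onto by a rank count (`surjective_of_comp_eq_comp`): `db ∘ dφ = dβ ∘ dz` with `dz`,
  `db` injective (immersions, `injective_mfderiv_of_isImmersionAt'`) and `dim ker dβ_{z p} = 1`,
  so `dim ker dφ_p ≤ 1` and `rank dφ_p ≥ 3 - 1 = 2 = dim S`;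
* `φ` is onto because `B` has empty interior (`interior_range_eq_empty_of_contMDiff`: a `C¹`
  image of a compact `2`-manifold in a `4`-manifold is nowhere dense, Hirsch Ch. 3 §1 Prop. 1.2 in
  the chart-wise form `dense_compl_image_of_contMDiffOn` of the tree), so `N ∖ B = β '' V` is
  dense, while `β '' closure V ⊇ β '' V` is compact, hence closed, hence all of `N`; as
  `closure V = V ∪ frontier V` and `β '' V = Bᶜ`, every point of `B` is `β (z p) = b (φ p)` for
  some `p`, and `b` is injective.
-/

noncomputable section

-- the prescribed namespace `Summit.<P>.<Sub>.…` duplicates `SmoothPoincare4` (P = Sub)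
set_option linter.dupNamespace false

open scoped Manifold ContDiff Topology ContinuousMap
open Set TopologicalSpace
open Literature.Topology.FourManifolds (singularHomologyZ sphereInversion IsTwistedSphere)
open Literature.Geometry.Kaehler (MForm IsSmoothForm IsClosedForm)

namespace Summit.SmoothPoincare4.SmoothPoincare4.Theorems.OrigamiRung.PairRigidityEndgame

/-- Model space `ℝⁿ`. -/
local notation "𝔼" n:arg => EuclideanSpace ℝ (Fin n)
/-- The round 4-sphere. -/
local notation "𝕊⁴" => (Metric.sphere (0 : EuclideanSpace ℝ (Fin 5)) 1)
/-- The round 2-sphere. -/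
local notation "𝕊²" => (Metric.sphere (0 : EuclideanSpace ℝ (Fin 3)) 1)
/-- The closed unit 4-ball with its manifold-with-boundary structure (`ClosedBall.lean`). -/
local notation "𝔻⁴" => (Metric.closedBall (0 : EuclideanSpace ℝ (Fin (3 + 1))) 1)

section FoldSubmersion

open Function Module Literature.Topology.FourManifolds

/-! ### Rank count -/

/-- **Rank count for a square `B ∘ A = C ∘ D` of linear maps.** If `A : V₁ → W` and
`C : V₂ → W'` are injective and `dim ker B + dim V₂ ≤ dim V₁`, then `D : V₁ → V₂` is onto:
`ker D = ker (C ∘ D) = ker (B ∘ A) = A⁻¹(ker B)` embeds by `A` into `ker B`, so by rank–nullity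
`rank D = dim V₁ - dim ker D ≥ dim V₂`. [folklore] -/
theorem surjective_of_comp_eq_comp {V₁ V₂ W W' : Type*} [AddCommGroup V₁] [Module ℝ V₁]
    [AddCommGroup V₂] [Module ℝ V₂] [AddCommGroup W] [Module ℝ W] [AddCommGroup W'] [Module ℝ W']
    [FiniteDimensional ℝ V₁] [FiniteDimensional ℝ V₂] [FiniteDimensional ℝ W]
    {A : V₁ →ₗ[ℝ] W} {B : W →ₗ[ℝ] W'} {C : V₂ →ₗ[ℝ] W'} {D : V₁ →ₗ[ℝ] V₂}
    (h : B.comp A = C.comp D) (hA : Injective A) (hC : Injective C)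
    (hdim : finrank ℝ (LinearMap.ker B) + finrank ℝ V₂ ≤ finrank ℝ V₁) : Surjective D := by
  have hker : LinearMap.ker D = (LinearMap.ker B).comap A := by
    rw [← LinearMap.ker_comp, h, LinearMap.ker_comp_of_ker_eq_bot _ (LinearMap.ker_eq_bot.2 hC)]
  have h1 : finrank ℝ (LinearMap.ker D) ≤ finrank ℝ (LinearMap.ker B) := by
    rw [hker]
    refine LinearMap.finrank_le_finrank_of_injective
      (f := A.restrict (p := (LinearMap.ker B).comap A) (q := LinearMap.ker B) fun x hx => hx) ?_
    intro x y hxy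
    apply Subtype.ext
    apply hA
    simpa [LinearMap.restrict_apply] using congrArg Subtype.val hxy
  have h2 := LinearMap.finrank_range_add_finrank_ker D
  have h3 : finrank ℝ V₂ ≤ finrank ℝ (LinearMap.range D) := by omega
  have h4 : LinearMap.range D = ⊤ :=
    Submodule.eq_top_of_finrank_eq (le_antisymm (Submodule.finrank_le _) h3)
  exact LinearMap.range_eq_top.1 h4

/-! ### Images of lower-dimensional compact manifolds are nowhere dense -/

/-- **The image of a compact `k`-manifold under a smooth map into an `n`-manifold, `k < n`, has
empty interior** (Hirsch, *Differential Topology*, Ch. 3 §1, Prop. 1.2).  At an interior point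
`x` of `range b`, read in the chart `ψ` at `x`: the open set `ψ(interior (range b) ∩ dom ψ)`
lies in the image `(ψ ∘ b)(b⁻¹ dom ψ)` of an open set of `S` under a `C¹` map into `ℝⁿ`, whose
complement is dense (`dense_compl_image_of_contMDiffOn`; a compact manifold is second
countable). [cite: HirschDT1976, Ch. 3 §1, Prop. 1.2] -/
theorem interior_range_eq_empty_of_contMDiff {k n : ℕ} (hkn : k < n)
    {S : Type*} [TopologicalSpace S] [CompactSpace S] [ChartedSpace (𝔼 k) S]
    [IsManifold (𝓡 k) ∞ S]
    {N : Type*} [TopologicalSpace N] [ChartedSpace (𝔼 n) N] [IsManifold (𝓡 n) ∞ N]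
    {b : S → N} (hb : ContMDiff (𝓡 k) (𝓡 n) ∞ b) : interior (range b) = ∅ := by
  haveI : SecondCountableTopology S := ChartedSpace.secondCountable_of_sigmaCompact (𝔼 k) S
  rw [eq_empty_iff_forall_notMem]
  intro x hx
  set ψ := chartAt (𝔼 n) x with hψ
  set W := interior (range b) ∩ ψ.source with hW
  have hWo : IsOpen W := isOpen_interior.inter ψ.open_source
  have hxW : x ∈ W := ⟨hx, mem_chart_source _ x⟩
  set T := b ⁻¹' ψ.source with hT
  have hTo : IsOpen T := ψ.open_source.preimage hb.continuous
  have hf : ContMDiffOn (𝓡 k) 𝓘(ℝ, 𝔼 n) 1 (ψ ∘ b) T := by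
    have h1 : ContMDiffOn (𝓡 n) (𝓡 n) 1 ψ ψ.source := contMDiffOn_chart
    exact h1.comp (hb.of_le (by simp)).contMDiffOn fun s hs => hs
  have hdense : Dense ((ψ ∘ b) '' T)ᶜ :=
    dense_compl_image_of_contMDiffOn hTo hf (by simpa [finrank_euclideanSpace_fin] using hkn)
  have hψW : IsOpen (ψ '' W) := ψ.isOpen_image_of_subset_source hWo inter_subset_right
  have hsub : ψ '' W ⊆ (ψ ∘ b) '' T := by
    rintro _ ⟨y, ⟨hy1, hy2⟩, rfl⟩
    obtain ⟨s, rfl⟩ := interior_subset hy1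
    exact ⟨s, hy2, rfl⟩
  obtain ⟨q, hq1, hq2⟩ := hdense.inter_open_nonempty _ hψW ⟨ψ x, x, hxW, rfl⟩
  exact hq2 (hsub hq1)

/-! ### The stub -/

/-- **Sub-goal `stub_pinch_foldSubmersion` of `stub_pinch` (line `pair-rigidity-endgame`): the
blow-down restricted to the fold is a surjective submersion onto the exceptional surface.**
With `b : S → N` a smooth embedding of a compact surface, `z : Z → M` a smooth embedding of a
`3`-manifold onto the fold `frontier V`, `β` smooth near `closure V` with `β '' V = (range b)ᶜ`,
`β '' frontier V ⊆ range b` and `dim ker dβ = 1` on the fold, the unique lift `φ : Z → S` of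
`β ∘ z` through `b` is smooth (`SchoenfliesTools.contMDiff_of_comp_isSmoothEmbedding`), satisfies
`b ∘ φ = β ∘ z`, is onto (`range b` is nowhere dense, `interior_range_eq_empty_of_contMDiff`, so
the compact set `β '' closure V ⊇ (range b)ᶜ` is all of `N`, and `closure V = V ∪ frontier V`),
and has onto differential everywhere (rank count `surjective_of_comp_eq_comp` applied to
`db ∘ dφ = dβ ∘ dz`). [folklore] -/
theorem stub_pinch_foldSubmersion : ∀ (M : Type) [TopologicalSpace M] [T2Space M] [SecondCountableTopology M] [CompactSpace M] [ChartedSpace (EuclideanSpace ℝ (Fin 4)) M] [IsManifold (𝓡 4) ∞ M] (N : Type) [TopologicalSpace N] [T2Space N] [SecondCountableTopology N] [ChartedSpace (EuclideanSpace ℝ (Fin 4)) N] [IsManifold (𝓡 4) ∞ N] (S : Type) [TopologicalSpace S] [CompactSpace S] [ChartedSpace (EuclideanSpace ℝ (Fin 2)) S] [IsManifold (𝓡 2) ∞ S] (Z : Type) [TopologicalSpace Z] [ChartedSpace (EuclideanSpace ℝ (Fin 3)) Z] [IsManifold (𝓡 3) ∞ Z] (V : TopologicalSpace.Opens M) (b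 : S → N) (β : M → N) (z : Z → M), Manifold.IsSmoothEmbedding (𝓡 2) (𝓡 4) ∞ b → Manifold.IsSmoothEmbedding (𝓡 3) (𝓡 4) ∞ z → Set.range z = frontier (V : Set M) → (∃ U : Set M, IsOpen U ∧ closure (V : Set M) ⊆ U ∧ ContMDiffOn (𝓡 4) (𝓡 4) ∞ β U) → β '' (V : Set M) = (Set.range b)ᶜ → β '' frontier (V : Set M) ⊆ Set.range b → (∀ x ∈ frontier (V : Set M), Module.finrank ℝ (LinearMap.ker (mfderiv (𝓡 4) (𝓡 4) β x).toLinearMap) = 1) → ∃ φ : Z → S, ContMDiff (𝓡 3) (𝓡 2) ∞ φ ∧ (∀ p, b (φ p) = β (z p)) ∧ Function.Surjective φ ∧ ∀ p, Function.Surjective (mfderiv (𝓡 3) (𝓡 2) φ p) := by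
  intro M _ _ _ _ _ _ N _ _ _ _ _ S _ _ _ _ Z _ _ _ V b β z hb hz hzV hβU hβV hβfr hker
  obtain ⟨U, hUo, hVU, hβ⟩ := hβU
  have hzfr : ∀ p, z p ∈ frontier (V : Set M) := fun p => hzV ▸ mem_range_self p
  have hzU : ∀ p, U ∈ 𝓝 (z p) := fun p =>
    hUo.mem_nhds (hVU (frontier_subset_closure (hzfr p)))
  have hβz : ContMDiff (𝓡 3) (𝓡 4) ∞ (β ∘ z) := fun p =>
    (hβ.contMDiffAt (hzU p)).comp p (hz.contMDiff p)
  -- the lift through the embedded surface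
  have hex : ∀ p, ∃ s, b s = β (z p) := fun p => hβfr ⟨z p, hzfr p, rfl⟩
  choose φ hφ using hex
  have hcomp : b ∘ φ = β ∘ z := funext hφ
  have hφs : ContMDiff (𝓡 3) (𝓡 2) ∞ φ :=
    SchoenfliesTools.contMDiff_of_comp_isSmoothEmbedding hb (hcomp ▸ hβz)
  refine ⟨φ, hφs, hφ, ?_, ?_⟩
  · -- surjectivity: `range b` is nowhere dense, so `β '' closure V = univ`
    have hint : interior (range b) = ∅ :=
      interior_range_eq_empty_of_contMDiff (by norm_num) hb.contMDiff
    have hcl : IsClosed (β '' closure (V : Set M)) :=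
      ((isClosed_closure.isCompact).image_of_continuousOn (hβ.continuousOn.mono hVU)).isClosed
    have hdense : Dense (range b)ᶜ := interior_eq_empty_iff_dense_compl.1 hint
    have huniv : β '' closure (V : Set M) = univ := by
      refine eq_univ_of_univ_subset ?_
      rw [← hdense.closure_eq, ← hβV]
      exact closure_minimal (image_mono subset_closure) hcl
    intro s
    have hs : b s ∈ β '' closure (V : Set M) := huniv ▸ mem_univ _
    obtain ⟨x, hx, hxs⟩ := hs
    rw [closure_eq_self_union_frontier] at hx
    rcases hx with hx | hx
    · have : b s ∈ (range b)ᶜ := hβV ▸ ⟨x, hx, hxs⟩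
      exact (this (mem_range_self s)).elim
    · rw [← hzV] at hx
      obtain ⟨p, rfl⟩ := hx
      refine ⟨p, hb.isEmbedding.injective ?_⟩
      rw [hφ p, hxs]
  · -- submersivity: `db ∘ dφ = dβ ∘ dz` with `dz`, `db` injective and `dim ker dβ = 1`
    intro p
    haveI : FiniteDimensional ℝ (TangentSpace (𝓡 3) p) :=
      inferInstanceAs (FiniteDimensional ℝ (𝔼 3))
    haveI : FiniteDimensional ℝ (TangentSpace (𝓡 2) (φ p)) :=
      inferInstanceAs (FiniteDimensional ℝ (𝔼 2))
    haveI : FiniteDimensional ℝ (TangentSpace (𝓡 4) (z p)) :=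
      inferInstanceAs (FiniteDimensional ℝ (𝔼 4))
    have h1 : MDifferentiableAt (𝓡 3) (𝓡 2) φ p := (hφs p).mdifferentiableAt (by simp)
    have h2 : MDifferentiableAt (𝓡 2) (𝓡 4) b (φ p) :=
      (hb.contMDiff (φ p)).mdifferentiableAt (by simp)
    have h3 : MDifferentiableAt (𝓡 3) (𝓡 4) z p := (hz.contMDiff p).mdifferentiableAt (by simp)
    have h4 : MDifferentiableAt (𝓡 4) (𝓡 4) β (z p) :=
      (hβ.contMDiffAt (hzU p)).mdifferentiableAt (by simp)
    have hchain : (mfderiv (𝓡 2) (𝓡 4) b (φ p)).comp (mfderiv (𝓡 3) (𝓡 2) φ p) =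
        (mfderiv (𝓡 4) (𝓡 4) β (z p)).comp (mfderiv (𝓡 3) (𝓡 4) z p) := by
      rw [← mfderiv_comp p h2 h1, hcomp, mfderiv_comp p h4 h3]
    have hA : Injective (mfderiv (𝓡 3) (𝓡 4) z p) :=
      injective_mfderiv_of_isImmersionAt' (hz.isImmersion.isImmersionAt p)
    have hC : Injective (mfderiv (𝓡 2) (𝓡 4) b (φ p)) :=
      injective_mfderiv_of_isImmersionAt' (hb.isImmersion.isImmersionAt (φ p))
    have hK := hker (z p) (hzfr p)
    have key := surjective_of_comp_eq_comp (A := (mfderiv (𝓡 3) (𝓡 4) z p).toLinearMap)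
      (B := (mfderiv (𝓡 4) (𝓡 4) β (z p)).toLinearMap)
      (C := (mfderiv (𝓡 2) (𝓡 4) b (φ p)).toLinearMap)
      (D := (mfderiv (𝓡 3) (𝓡 2) φ p).toLinearMap)
      (by
        rw [← ContinuousLinearMap.toLinearMap_comp, ← ContinuousLinearMap.toLinearMap_comp]
        exact congrArg ContinuousLinearMap.toLinearMap hchain.symm) hA hC
      (by
        rw [hK]
        show 1 + finrank ℝ (𝔼 2) ≤ finrank ℝ (𝔼 3)
        simp)
    simpa using key

end FoldSubmersion

end Summit.SmoothPoincare4.SmoothPoincare4.Theorems.OrigamiRung.PairRigidityEndgame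

end
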